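import Literature.AlgebraicGeometry.Limits.GroupLawTransferAlong
import Literature.AlgebraicGeometry.Limits.LocalizationGroupSpread
import Literature.AlgebraicGeometry.Limits.StageRestriction
import HarnessLib

/-!
# A group law on the generic fibre of a scheme over a RELATIVE stage `P ⊗ D(t)` descends to a finer stage `P ⊗ D(s)` (EGA IV₃ 8.8.2, relative base)

Topic `Literature/AlgebraicGeometry/Limits`; namespace `Literature.AlgebraicGeometry.Limits.LocApprox`.  DEFINITIONS with bodies (`overOf`, `stageOver`,
`genOver`, `relLeg`, `stageMap`, `bridgeHom ∕ bridgeToProd ∕ bridgeInv ∕ bridgeIso`) + THEOREMS; no instance, no notation, no named fact, no `sorry`.  Cell `hodgecm-mathlib` (D-0151), FLOOR 0, P6 «MOD programme»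
(crux hLiu418 = stmt-HodgeConjecture-24832, `--supports`, count-neutral), SPREAD door (LEAD F0P6-plan M-17m), organ (α) SP1 (d) «RELATIVE GROUP-LAW SPREAD»
(A-p06 (g31) `CENSUS-SP1-AbelianSchemeSpreadStage` §3 (d); LEAD 20:42:56Z), FILE 2 of 2 — the instantiation of ★ FILE 1 `Limits/GroupLawTransferAlong`
at the localisation tower, plus the EXISTENCE of spreadings (relative 8.8.2 (i)).  HC_CM is proved only modulo the printed citations (2 remaining named inputs
hLiu418, h413) until rung 0 closes; nothing here is about HC.

SETTING (★ `Limits/LocalizationDiagram`, `LocalizationProdLimit`, `StageRestriction`): `B = A_S`, `P → Spec A` an `A`-scheme, the STAGES `P ⊗ D(s)`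
(`D(s) = (baseDiagram S).obj s = Spec A[1∕s]`), the GENERIC BASE `P ⊗ Spec B`, legs `leg S B s : Spec B → D(s)`.  Fix a stage `t`; the RELATIVE base is the
scheme `(P ⊗ D(t)).left`, over which sit the finer stages `stageOver ρ = (P ⊗ D(s) → P ⊗ D(t))` (`ρ : s ⟶ t`) and the generic base `genOver t = (P ⊗ Spec B →
P ⊗ D(t))`, linked by `relLeg ρ : genOver t ⟶ stageOver ρ` — the `ℓ : G ⟶ T` over `X` of ★ FILE 1.  For `Y : Over (P ⊗ D(t)).left`: `Y|ₛ = Y ×_{P_t} P_s =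
(Over.pullback (stageOver ρ).hom).obj Y` and `Y_B = (Over.pullback (genOver t).hom).obj Y` (the memo՚s `(Over.pullback (π t)).obj Y`, `π t = (P ◁ (baseCone S B).π.app t).left`).

* §1 the objects, legs and transitions; `relLeg ρ` is quasi-compact, and SCHEME-THEORETICALLY DOMINANT when `Spec B → D(s)` is and `P → Spec A` is flat
  (★ `StageRestriction.isSchemeTheoreticallyDominant_whiskerLeft_left`) — so ★ FILE 1 `GrpSpreadAlong.grpObj ∕ isMonHom_facObjIso_hom ∕ isCommMonObj` apply at
  `ℓ := relLeg ρ` under stage-flatness of `P`, `[IsSchemeTheoreticallyDominant (leg S B s).left]`, `[Flat (Y|ₛ).hom] [IsSeparated (Y|ₛ).hom]` (FILE 3 docks them).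
* §2 the BRIDGE `bridgeIso τ Q : (Q ⊗ overOf τ).left ≅ ((Over.map (P ⊗ D t).hom).obj Q ⊗ T).left` for `τ : T ⟶ D(t)` — «a `P_t`-scheme times `P ⊗ T` over `P_t` is the
  `A`-scheme `Q` times `T`» (`D(t) ↪ Spec A` is a monomorphism) — and its compatibility with the legs.
* §3 RELATIVE 8.8.2 (i): **`exists_whiskerLeft_relLeg_comp_eq`** — a `P_t`-morphism `Q ⊗ genOver t ⟶ Y` (`Q` qcqs over `P_t`, `Y` locally of finite presentation over
  `P_t`, `P` qcqs over `A`) is the restriction of a `P_t`-morphism `Q ⊗ stageOver ρ ⟶ Y` for some `ρ : s ⟶ t` (Mathlib `Scheme.exists_π_app_comp_eq_of_locallyOfFinitePresentation`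
  over ★ `isLimitProdCone` for the `A`-scheme `Q`, through the bridge); **`exists_grpSpreadAlong`** — the three structure maps of a group law on `Y_B` spread to a
  common stage: `∃ s (ρ : s ⟶ t), Nonempty (GrpSpreadAlong (relLeg ρ) Y)`.

THE PRINT: [EGAIV3] Thm. 8.8.2 (i)–(ii); [StacksProject] Tags 01ZC, 01ZM; [GortzWedhorn2020] Thm. 10.57, Cor. 10.64, §(4.7).

## References
* [EGAIV3] A. Grothendieck, J. Dieudonné, *EGA IV₃*, Publ. Math. IHÉS 28 (1966), Thm. 8.8.2, 11.10.5.
* [StacksProject] The Stacks Project, Tags 01ZC, 01ZM.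
* [GortzWedhorn2020] U. Görtz, T. Wedhorn, *Algebraic Geometry I*, 2nd ed. (2020), §(4.7) (4.7.1), Prop. 4.16, Thm. 10.57, Cor. 10.64, §(10.13).
-/

set_option autoImplicit false

noncomputable section

universe u

open CategoryTheory CategoryTheory.Limits AlgebraicGeometry MonoidalCategory CartesianMonoidalCategory MonObj
open Functor.LaxMonoidal Functor.OplaxMonoidal
open scoped CategoryTheory.Obj

namespace Literature.AlgebraicGeometry.Limits

namespace LocApprox

open Literature.AlgebraicGeometry.Motives (SchemeOver specOver)
open Literature.AlgebraicGeometry.Limits.OverFac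

set_option backward.isDefEq.respectTransparency false

variable {A : Type u} [CommRing A] (S : Submonoid A) (B : Type u) [CommRing B] [Algebra A B] [IsLocalization S B]
  (P : SchemeOver A)

/-! ## §1 Relative stages over the base stage `P ⊗ D(t)` -/

/-- `P ⊗ T` as a scheme over the base stage `P ⊗ D(t)`, for an `A`-morphism `τ : T ⟶ D(t)` (structure map `P ◁ τ`). [cite: GortzWedhorn2020, §(4.7)] -/
abbrev overOf {t : Idx S} {T : SchemeOver A} (τ : T ⟶ (baseDiagram S).obj t) : Over (P ⊗ (baseDiagram S).obj t).left :=
  Over.mk (P ◁ τ).left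

/-- The finer stage `P ⊗ D(s) → P ⊗ D(t)` (`ρ : s ⟶ t`, transition `P ◁ D(ρ)`), as a scheme over `P ⊗ D(t)`. [cite: GortzWedhorn2020, §(10.13)] -/
abbrev stageOver {s t : Idx S} (ρ : s ⟶ t) : Over (P ⊗ (baseDiagram S).obj t).left :=
  overOf S P ((baseDiagram S).map ρ)

/-- The generic base `P ⊗ Spec B → P ⊗ D(t)` (the cone leg `P ◁ π_t`), as a scheme over `P ⊗ D(t)`. [cite: GortzWedhorn2020, §(10.13)] -/
abbrev genOver (t : Idx S) : Over (P ⊗ (baseDiagram S).obj t).left :=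
  overOf S P (leg S B t)

/-- `leg S B s ≫ D(ρ) = leg S B t` on `P ⊗ –`, underlying schemes. [cite: GortzWedhorn2020, §(10.13)] -/
theorem whiskerLeft_leg_left_comp_whiskerLeft_map_left {s t : Idx S} (ρ : s ⟶ t) :
    (P ◁ leg S B s).left ≫ (P ◁ (baseDiagram S).map ρ).left = (P ◁ leg S B t).left := by
  rw [← Over.comp_left, ← MonoidalCategory.whiskerLeft_comp, leg_comp_map]

/-- **The relative leg** `P ⊗ Spec B ⟶ P ⊗ D(s)` over `P ⊗ D(t)` — the `ℓ : G ⟶ T` of ★ `GroupLawTransferAlong`. [cite: GortzWedhorn2020, §(10.13)] -/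
abbrev relLeg {s t : Idx S} (ρ : s ⟶ t) : genOver S B P t ⟶ stageOver S P ρ :=
  Over.homMk (P ◁ leg S B s).left (whiskerLeft_leg_left_comp_whiskerLeft_map_left S B P ρ)

/-- Transitions compose on `P ⊗ –`, underlying schemes. [cite: GortzWedhorn2020, §(10.13)] -/
theorem whiskerLeft_map_left_comp_whiskerLeft_map_left {r s t : Idx S} (σ : r ⟶ s) (ρ : s ⟶ t) :
    (P ◁ (baseDiagram S).map σ).left ≫ (P ◁ (baseDiagram S).map ρ).left = (P ◁ (baseDiagram S).map (σ ≫ ρ)).left := by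
  rw [← Over.comp_left, ← MonoidalCategory.whiskerLeft_comp, Functor.map_comp]

/-- The transition `P ⊗ D(r) ⟶ P ⊗ D(s)` between relative stages over `P ⊗ D(t)` (`σ : r ⟶ s`, `ρₛ : s ⟶ t`, `ρ : r ⟶ t`; the index category is thin,
so `σ ≫ ρₛ = ρ` automatically). [cite: GortzWedhorn2020, §(10.13)] -/
abbrev stageMap {r s t : Idx S} (σ : r ⟶ s) (ρₛ : s ⟶ t) (ρ : r ⟶ t) : stageOver S P ρ ⟶ stageOver S P ρₛ :=
  Over.homMk (P ◁ (baseDiagram S).map σ).left (by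
    have hρ : σ ≫ ρₛ = ρ := Subsingleton.elim _ _
    subst hρ
    exact whiskerLeft_map_left_comp_whiskerLeft_map_left S P σ ρₛ)

/-- The relative legs are compatible with the transitions: `relLeg ρ ≫ stageMap σ ρₛ ρ = relLeg ρₛ`. [cite: GortzWedhorn2020, §(10.13)] -/
theorem relLeg_comp_stageMap {r s t : Idx S} (σ : r ⟶ s) (ρₛ : s ⟶ t) (ρ : r ⟶ t) :
    relLeg S B P ρ ≫ stageMap S P σ ρₛ ρ = relLeg S B P ρₛ := by
  ext : 1
  change (P ◁ leg S B r).left ≫ (P ◁ (baseDiagram S).map σ).left = (P ◁ leg S B s).left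
  exact whiskerLeft_leg_left_comp_whiskerLeft_map_left S B P σ

/-- The relative leg is quasi-compact (base change of the affine `Spec B → D(s)`). [cite: EGAIV3, Thm. 8.8.2] -/
theorem quasiCompact_relLeg_left {s t : Idx S} (ρ : s ⟶ t) : QuasiCompact (relLeg S B P ρ).left := by
  haveI : IsAffine (specOver A B).left := inferInstanceAs (IsAffine (Spec (CommRingCat.of B)))
  haveI : IsAffineHom (leg S B s).left := isAffineHom_of_isAffine _
  change QuasiCompact (P ◁ leg S B s).left
  infer_instance

/-- **The relative leg is scheme-theoretically dominant** when `Spec B → D(s)` is (e.g. `A` a domain, `S ⊆ A ∖ {0}`) and the STAGE `P ⊗ D(s) → D(s)` is flat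
(automatic from `[Flat P.hom]`; ★ `isSchemeTheoreticallyDominant_whiskerLeft_left`: flat base change preserves schematic dominance, EGA IV₃ 11.10.5). [cite: EGAIV3, 11.10.5] -/
theorem isSchemeTheoreticallyDominant_relLeg_left {s t : Idx S} (ρ : s ⟶ t) [Flat (pullback.snd P.hom ((baseDiagram S).obj s).hom)]
    [IsSchemeTheoreticallyDominant (leg S B s).left] : IsSchemeTheoreticallyDominant (relLeg S B P ρ).left := by
  haveI : IsAffine (specOver A B).left := inferInstanceAs (IsAffine (Spec (CommRingCat.of B)))
  haveI : IsAffineHom (leg S B s).left := isAffineHom_of_isAffine _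
  change IsSchemeTheoreticallyDominant (P ◁ leg S B s).left
  exact isSchemeTheoreticallyDominant_whiskerLeft_left P (leg S B s)


/-! ## §2 The bridge: `Q ×_{P ⊗ D(t)} (P ⊗ T) ≅ Q ×_A T` for a `P ⊗ D(t)`-scheme `Q` and `τ : T ⟶ D(t)` -/

section Bridge

variable {S P} {t : Idx S} {T : SchemeOver A} (τ : T ⟶ (baseDiagram S).obj t) (Q : Over (P ⊗ (baseDiagram S).obj t).left)

/-- The structure map of `overOf τ` is `P ◁ τ` (by `rfl`). [cite: GortzWedhorn2020, §(4.7)] -/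
theorem overOf_hom : (overOf S P τ).hom = (P ◁ τ).left := rfl

/-- `overOf τ → P ⊗ D(t) → Spec A` is `P ⊗ T → Spec A`. [cite: GortzWedhorn2020, §(4.7)] -/
theorem overOf_hom_comp_hom : (overOf S P τ).hom ≫ (P ⊗ (baseDiagram S).obj t).hom = (P ⊗ T).hom := Over.w (P ◁ τ)

/-- `overOf τ → P ⊗ D(t) → P` is the first projection of `P ⊗ T`. [cite: GortzWedhorn2020, §(4.7)] -/
theorem overOf_hom_comp_fst : (overOf S P τ).hom ≫ pullback.fst P.hom ((baseDiagram S).obj t).hom = pullback.fst P.hom T.hom :=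
  Over.whiskerLeft_left_fst τ

/-- `overOf τ → P ⊗ D(t) → D(t)` is `P ⊗ T → T → D(t)`. [cite: GortzWedhorn2020, §(4.7)] -/
theorem overOf_hom_comp_snd : (overOf S P τ).hom ≫ pullback.snd P.hom ((baseDiagram S).obj t).hom = pullback.snd P.hom T.hom ≫ τ.left :=
  Over.whiskerLeft_left_snd τ

/-- `P ⊗ D(t) → P → Spec A` is the structure map of `P ⊗ D(t)`. [cite: GortzWedhorn2020, §(4.7)] -/
theorem fst_comp_hom : pullback.fst P.hom ((baseDiagram S).obj t).hom ≫ P.hom = (P ⊗ (baseDiagram S).obj t).hom :=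
  Over.w (fst P ((baseDiagram S).obj t))

/-- `P ⊗ D(t) → D(t) → Spec A` is the structure map of `P ⊗ D(t)`. [cite: GortzWedhorn2020, §(4.7)] -/
theorem snd_left_comp_hom : pullback.snd P.hom ((baseDiagram S).obj t).hom ≫ ((baseDiagram S).obj t).hom = (P ⊗ (baseDiagram S).obj t).hom :=
  Over.w (snd P ((baseDiagram S).obj t))

/-- The pullback square of `Q ×_A T` (`Q` read as an `A`-scheme through `P ⊗ D(t) → Spec A`). [cite: GortzWedhorn2020, §(4.7)] -/
theorem map_condition :
    pullback.fst ((Over.map (P ⊗ (baseDiagram S).obj t).hom).obj Q).hom T.hom ≫ Q.hom ≫ (P ⊗ (baseDiagram S).obj t).hom =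
      pullback.snd ((Over.map (P ⊗ (baseDiagram S).obj t).hom).obj Q).hom T.hom ≫ T.hom := by
  rw [← Over.map_obj_hom]
  exact pullback.condition

/-- The forward map `Q ×_{P_t} (P ⊗ T) ⟶ Q ×_A T`, `(q, (p, θ)) ↦ (q, θ)`. [cite: GortzWedhorn2020, §(4.7) Prop. 4.16] -/
def bridgeHom : (Q ⊗ overOf S P τ).left ⟶ ((Over.map (P ⊗ (baseDiagram S).obj t).hom).obj Q ⊗ T).left :=
  pullback.lift (pullback.fst Q.hom (overOf S P τ).hom) (pullback.snd Q.hom (overOf S P τ).hom ≫ pullback.snd P.hom T.hom) (by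
    rw [Over.map_obj_hom, pullback.condition_assoc, overOf_hom_comp_hom, Category.assoc]
    exact congrArg (pullback.snd Q.hom (overOf S P τ).hom ≫ ·) (Over.w (snd P T)).symm)

/-- The map `Q ×_A T ⟶ P ⊗ T`, `(q, θ) ↦ (q̄, θ)` with `q̄` the image of `q` in `P`. [cite: GortzWedhorn2020, §(4.7) Prop. 4.16] -/
def bridgeToProd : ((Over.map (P ⊗ (baseDiagram S).obj t).hom).obj Q ⊗ T).left ⟶ (overOf S P τ).left :=
  pullback.lift (pullback.fst _ _ ≫ Q.hom ≫ pullback.fst P.hom ((baseDiagram S).obj t).hom) (pullback.snd _ _) (by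
    rw [Category.assoc, Category.assoc, fst_comp_hom]
    exact map_condition Q)

/-- `bridgeToProd ≫ (P ◁ τ) = fst ≫ Q.hom`: uses that `D(t) ↪ Spec A` is a monomorphism. [cite: GortzWedhorn2020, §(4.7) Prop. 4.16] -/
theorem bridgeToProd_comp_overOf_hom :
    bridgeToProd τ Q ≫ (overOf S P τ).hom = pullback.fst _ _ ≫ Q.hom := by
  apply pullback.hom_ext
  · rw [Category.assoc, overOf_hom_comp_fst, bridgeToProd, pullback.lift_fst, Category.assoc]
  · rw [Category.assoc, overOf_hom_comp_snd, bridgeToProd, pullback.lift_snd_assoc,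
      ← cancel_mono ((baseDiagram S).obj t).hom, Category.assoc, Category.assoc, Category.assoc, Over.w τ, snd_left_comp_hom]
    exact (map_condition Q).symm

/-- The backward map `Q ×_A T ⟶ Q ×_{P_t} (P ⊗ T)`. [cite: GortzWedhorn2020, §(4.7) Prop. 4.16] -/
def bridgeInv : ((Over.map (P ⊗ (baseDiagram S).obj t).hom).obj Q ⊗ T).left ⟶ (Q ⊗ overOf S P τ).left :=
  pullback.lift (pullback.fst _ _) (bridgeToProd τ Q) (bridgeToProd_comp_overOf_hom τ Q).symm

/-- **THE BRIDGE `Q ×_{P ⊗ D(t)} (P ⊗ T) ≅ Q ×_A T`** (as schemes; `Q` a `P ⊗ D(t)`-scheme, `τ : T ⟶ D(t)`): the first factor is unchanged and the second is read through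
`P ⊗ T → T`; an isomorphism because `D(t) → Spec A` is a monomorphism. [cite: GortzWedhorn2020, §(4.7) Prop. 4.16] -/
def bridgeIso : (Q ⊗ overOf S P τ).left ≅ ((Over.map (P ⊗ (baseDiagram S).obj t).hom).obj Q ⊗ T).left where
  hom := bridgeHom τ Q
  inv := bridgeInv τ Q
  hom_inv_id := by
    apply pullback.hom_ext
    · rw [Category.assoc, bridgeInv, pullback.lift_fst, bridgeHom, pullback.lift_fst, Category.id_comp]
    · rw [Category.assoc, bridgeInv, pullback.lift_snd, Category.id_comp]
      apply pullback.hom_ext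
      · rw [Category.assoc, bridgeToProd, pullback.lift_fst, bridgeHom, pullback.lift_fst_assoc, pullback.condition_assoc,
          overOf_hom_comp_fst]
      · rw [Category.assoc, bridgeToProd, pullback.lift_snd, bridgeHom, pullback.lift_snd]
  inv_hom_id := by
    apply pullback.hom_ext
    · rw [Category.assoc, bridgeHom, pullback.lift_fst, bridgeInv, pullback.lift_fst, Category.id_comp]
    · rw [Category.assoc, bridgeHom, pullback.lift_snd, bridgeInv, pullback.lift_snd_assoc, bridgeToProd, pullback.lift_snd,
        Category.id_comp]

/-- First projection of the bridge. [cite: GortzWedhorn2020, §(4.7) Prop. 4.16] -/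
@[reassoc]
theorem bridgeIso_hom_fst : (bridgeIso τ Q).hom ≫ pullback.fst _ _ = pullback.fst Q.hom (overOf S P τ).hom :=
  pullback.lift_fst _ _ _

/-- Second projection of the bridge. [cite: GortzWedhorn2020, §(4.7) Prop. 4.16] -/
@[reassoc]
theorem bridgeIso_hom_snd : (bridgeIso τ Q).hom ≫ pullback.snd _ _ = pullback.snd Q.hom (overOf S P τ).hom ≫ pullback.snd P.hom T.hom :=
  pullback.lift_snd _ _ _

/-- **The bridge is compatible with the legs**: for `g : T' ⟶ T` and a morphism `m : overOf τ' ⟶ overOf τ` over `P ⊗ D(t)` with underlying map `P ◁ g`,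
the square `(Q ◁ m) ≫ bridge_τ = bridge_τ' ≫ (Q_A ◁ g)` commutes. [cite: GortzWedhorn2020, §(4.7) Prop. 4.16] -/
theorem whiskerLeft_left_comp_bridgeIso_hom {T' : SchemeOver A} (g : T' ⟶ T) (τ' : T' ⟶ (baseDiagram S).obj t)
    (m : overOf S P τ' ⟶ overOf S P τ) (hm : m.left = (P ◁ g).left) :
    (Q ◁ m).left ≫ (bridgeIso τ Q).hom = (bridgeIso τ' Q).hom ≫ (((Over.map (P ⊗ (baseDiagram S).obj t).hom).obj Q) ◁ g).left := by
  apply pullback.hom_ext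
  · rw [Category.assoc, Category.assoc, bridgeIso_hom_fst, Over.whiskerLeft_left_fst, Over.whiskerLeft_left_fst, bridgeIso_hom_fst]
  · rw [Category.assoc, Category.assoc, bridgeIso_hom_snd, Over.whiskerLeft_left_snd, Over.whiskerLeft_left_snd_assoc, hm,
      bridgeIso_hom_snd_assoc, Category.assoc]
    change _ ≫ (P ◁ g).left ≫ (snd P T).left = _ ≫ (snd P T').left ≫ g.left
    rw [← Over.comp_left, whiskerLeft_snd, Over.comp_left]

end Bridge

/-! ## §3 Relative EGA IV₃ 8.8.2 (i): morphisms out of `Q ⊗ (P ⊗ Spec B)` spread to a stage; the structure maps of a group law spread -/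

section Spread

variable {S P} {t : Idx S}

/-- `Q`, read as an `A`-scheme through `P ⊗ D(t) → Spec A`, is quasi-compact over `A` when `Q → P ⊗ D(t)` and `P → Spec A` are. [cite: EGAIV3, Thm. 8.8.2] -/
theorem quasiCompact_map_hom [QuasiCompact P.hom] (Q : Over (P ⊗ (baseDiagram S).obj t).left) [QuasiCompact Q.hom] :
    QuasiCompact ((Over.map (P ⊗ (baseDiagram S).obj t).hom).obj Q).hom :=
  inferInstanceAs (QuasiCompact (Q.hom ≫ pullback.fst P.hom ((baseDiagram S).obj t).hom ≫ P.hom))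

/-- The same for quasi-separatedness. [cite: EGAIV3, Thm. 8.8.2] -/
theorem quasiSeparated_map_hom [QuasiSeparated P.hom] (Q : Over (P ⊗ (baseDiagram S).obj t).left) [QuasiSeparated Q.hom] :
    QuasiSeparated ((Over.map (P ⊗ (baseDiagram S).obj t).hom).obj Q).hom :=
  inferInstanceAs (QuasiSeparated (Q.hom ≫ pullback.fst P.hom ((baseDiagram S).obj t).hom ≫ P.hom))

/-- **RELATIVE EGA IV₃ 8.8.2 (i) (existence half).**  Let `Q`, `Y` be schemes over the stage `P ⊗ D(t)`, `Q` quasi-compact quasi-separated and `Y` locally of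
finite presentation over it (`P` quasi-compact quasi-separated over `A`).  Every `P ⊗ D(t)`-morphism `a : Q ×_{P_t} (P ⊗ Spec B) ⟶ Y` is the restriction along the
relative leg of a `P ⊗ D(t)`-morphism `g : Q ×_{P_t} (P ⊗ D(s)) ⟶ Y` for some finer stage `ρ : s ⟶ t`: through the bridge §2, `Q ×_{P_t} (P ⊗ –)` is the
`A`-scheme `Q` times `–`, whose generic member is the limit of its stages (★ `isLimitProdCone`), and Mathlib՚s `Scheme.exists_π_app_comp_eq_of_locallyOfFinitePresentation`
(Stacks 01ZC) over the base `P ⊗ D(t)` applies. [cite: EGAIV3, Thm. 8.8.2 (i)] [cite: StacksProject, Tag 01ZC] [cite: GortzWedhorn2020, Thm. 10.57 and Cor. 10.64] -/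
theorem exists_whiskerLeft_relLeg_comp_eq [QuasiCompact P.hom] [QuasiSeparated P.hom] (Q Y : Over (P ⊗ (baseDiagram S).obj t).left)
    [QuasiCompact Q.hom] [QuasiSeparated Q.hom]
    [LocallyOfFinitePresentation Y.hom] (a : Q ⊗ genOver S B P t ⟶ Y) :
    ∃ (s : Idx S) (ρ : s ⟶ t) (g : Q ⊗ stageOver S P ρ ⟶ Y), (Q ◁ relLeg S B P ρ) ≫ g = a := by
  -- `Q` as an `A`-scheme and the limit cone of its stages
  let QA : SchemeOver A := (Over.map (P ⊗ (baseDiagram S).obj t).hom).obj Q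
  haveI : QuasiCompact QA.hom := quasiCompact_map_hom Q
  haveI : QuasiSeparated QA.hom := quasiSeparated_map_hom Q
  -- the structure maps `(Q_A ⊗ D(s)).left → (P ⊗ D(t)).left`
  let tY : prodDiagram S QA ⟶ (Functor.const (Idx S)).obj (P ⊗ (baseDiagram S).obj t).left :=
    { app := fun s => pullback.fst QA.hom ((baseDiagram S).obj s).hom ≫ Q.hom
      naturality := fun s s' f => by
        change (QA ◁ (baseDiagram S).map f).left ≫ pullback.fst QA.hom ((baseDiagram S).obj s').hom ≫ Q.hom = _ ≫ 𝟙 _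
        rw [Over.whiskerLeft_left_fst_assoc, Category.comp_id] }
  let a' : (prodCone S B QA).pt ⟶ Y.left := (bridgeIso (leg S B t) Q).inv ≫ a.left
  have ha : (prodCone S B QA).π ≫ tY = (Functor.const (Idx S)).map (a' ≫ Y.hom) := by
    ext s
    change (QA ◁ leg S B s).left ≫ pullback.fst QA.hom ((baseDiagram S).obj s).hom ≫ Q.hom =
      ((bridgeIso (leg S B t) Q).inv ≫ a.left) ≫ Y.hom
    rw [Over.whiskerLeft_left_fst_assoc, Category.assoc, Over.w a, Over.tensorObj_hom Q (genOver S B P t)]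
    change _ = (bridgeIso (leg S B t) Q).inv ≫ pullback.fst Q.hom (overOf S P (leg S B t)).hom ≫ Q.hom
    rw [← bridgeIso_hom_fst_assoc (leg S B t) Q, Iso.inv_hom_id_assoc]
  obtain ⟨s, g', hg', hg'Y⟩ := Scheme.exists_π_app_comp_eq_of_locallyOfFinitePresentation (prodDiagram S QA) tY Y.hom
    (prodCone S B QA) (isLimitProdCone S B QA) a' ha
  -- a common refinement of `s` and `t`
  obtain ⟨r, ⟨σ⟩, ⟨ρ⟩⟩ := exists_hom₂ S s t
  have hw : ((bridgeIso ((baseDiagram S).map ρ) Q).hom ≫ (QA ◁ (baseDiagram S).map σ).left ≫ g') ≫ Y.hom = (Q ⊗ stageOver S P ρ).hom := by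
    rw [Category.assoc, Category.assoc, hg'Y, Over.tensorObj_hom Q (stageOver S P ρ)]
    change _ ≫ _ ≫ pullback.fst QA.hom ((baseDiagram S).obj s).hom ≫ Q.hom = pullback.fst Q.hom (stageOver S P ρ).hom ≫ Q.hom
    rw [Over.whiskerLeft_left_fst_assoc, bridgeIso_hom_fst_assoc]
  refine ⟨r, ρ, Over.homMk _ hw, ?_⟩
  ext : 1
  change (Q ◁ relLeg S B P ρ).left ≫ (bridgeIso ((baseDiagram S).map ρ) Q).hom ≫ (QA ◁ (baseDiagram S).map σ).left ≫ g' = a.left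
  rw [reassoc_of% (whiskerLeft_left_comp_bridgeIso_hom ((baseDiagram S).map ρ) Q (leg S B r) (leg S B t) (relLeg S B P ρ) rfl),
    ← Over.comp_left_assoc, ← MonoidalCategory.whiskerLeft_comp, leg_comp_map]
  change (bridgeIso (leg S B t) Q).hom ≫ (prodCone S B QA).π.app s ≫ g' = a.left
  rw [hg', Iso.hom_inv_id_assoc]

/-- **THE STRUCTURE MAPS OF A GROUP LAW ON `Y_B` SPREAD TO A COMMON STAGE** (`Y` quasi-compact, quasi-separated and locally of finite presentation over
`P ⊗ D(t)`, `P` quasi-compact quasi-separated over `A`): three applications of `exists_whiskerLeft_relLeg_comp_eq` and a common refinement — the datum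
`GrpSpreadAlong (relLeg ρ) Y` of ★ `GroupLawTransferAlong` at some `ρ : s ⟶ t`.  With ★ `GrpSpreadAlong.grpObj` (`grpObj_stage` above) this is EGA IV₃ 8.8.2
for group objects over a relative base. [cite: EGAIV3, Thm. 8.8.2] [cite: StacksProject, Tag 01ZM] -/
theorem exists_grpSpreadAlong [QuasiCompact P.hom] [QuasiSeparated P.hom] (Y : Over (P ⊗ (baseDiagram S).obj t).left)
    [QuasiCompact Y.hom] [QuasiSeparated Y.hom]
    [LocallyOfFinitePresentation Y.hom] [GrpObj ((Over.pullback (genOver S B P t).hom).obj Y)] :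
    ∃ (s : Idx S) (ρ : s ⟶ t), Nonempty (GrpSpreadAlong (relLeg S B P ρ) Y) := by
  haveI : QuasiCompact (Y ⊗ Y).hom := inferInstanceAs (QuasiCompact (pullback.fst Y.hom Y.hom ≫ Y.hom))
  haveI : QuasiSeparated (Y ⊗ Y).hom := inferInstanceAs (QuasiSeparated (pullback.fst Y.hom Y.hom ≫ Y.hom))
  haveI : QuasiCompact (𝟙_ (Over (P ⊗ (baseDiagram S).obj t).left)).hom := inferInstanceAs (QuasiCompact (𝟙 _))
  haveI : QuasiSeparated (𝟙_ (Over (P ⊗ (baseDiagram S).obj t).left)).hom := inferInstanceAs (QuasiSeparated (𝟙 _))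
  obtain ⟨s₁, ρ₁, g₁, h₁⟩ := exists_whiskerLeft_relLeg_comp_eq B (Y ⊗ Y) Y (OverFac.mulExt (genOver S B P t) Y)
  obtain ⟨s₂, ρ₂, g₂, h₂⟩ := exists_whiskerLeft_relLeg_comp_eq B (𝟙_ _) Y (OverFac.oneExt (genOver S B P t) Y)
  obtain ⟨s₃, ρ₃, g₃, h₃⟩ := exists_whiskerLeft_relLeg_comp_eq B Y Y (OverFac.invExt (genOver S B P t) Y)
  obtain ⟨r', ⟨σ₁'⟩, ⟨σ₂'⟩⟩ := exists_hom₂ S s₁ s₂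
  obtain ⟨r, ⟨σ'⟩, ⟨σ₃⟩⟩ := exists_hom₂ S r' s₃
  let ρ : r ⟶ t := σ' ≫ σ₁' ≫ ρ₁
  refine ⟨r, ρ, ⟨⟨((Y ⊗ Y) ◁ stageMap S P (σ' ≫ σ₁') ρ₁ ρ) ≫ g₁, (𝟙_ _ ◁ stageMap S P (σ' ≫ σ₂') ρ₂ ρ) ≫ g₂,
    (Y ◁ stageMap S P σ₃ ρ₃ ρ) ≫ g₃, ?_, ?_, ?_⟩⟩⟩
  · rw [← MonoidalCategory.whiskerLeft_comp_assoc, relLeg_comp_stageMap, h₁]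
  · rw [← MonoidalCategory.whiskerLeft_comp_assoc, relLeg_comp_stageMap, h₂]
  · rw [← MonoidalCategory.whiskerLeft_comp_assoc, relLeg_comp_stageMap, h₃]

end Spread

end LocApprox

end Literature.AlgebraicGeometry.Limits

end
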